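import Summits.QuantumFields.YangMills.Theorems.FluctuationComparisonRegPrIntLOrganTangentFlatAnchorEven
import Literature.MathematicalPhysics.QuantumFieldTheory.Balaban1983to89.BalabanUVClass
import Literature.MathematicalPhysics.QuantumFieldTheory.Balaban1983to89.T4ReTrLipUnitary
import HarnessLib

/-!
# THE ORGAN'S DENSITIES AND DISCREPANCY ARE GAUGE INVARIANT — BY KERNEL, FROM CLAUSE ⑧ OF THE FRAME (ideator №21 hole (i))

Cell `ym3-torus` (YM ladder rung R3 = continuum `SU(2)` Yang–Mills on the three-torus — a RUNG, NOT d = 4, NOT infinite volume, NOT a mass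
gap, NOT Clay).  LEAD-20520 width seat `ym-ust-20520-w3` (gen 24); `--supports stmt-QuantumFields-20520 --as helper`, count-neutral,
definition-free, default heartbeats; no registry, binder or `Lines/` edit (registered skeleton `Lines/semiclassical_s2beta.lean` v11.4, 0∕5,
★★OWNER RULING №36, untouched).

WHAT THIS IS.  In the frame of the organ O1 `OneStepContractionRun` (LINE g25-1 «organ_tangent» v2.6 ∕ package `runpair_organ` v17.2) the
tower densities `ρ j`, `ρ′ j` carry clause ⑧ «membership modulo a constant»: `∃ κ, MemAtHeight F ℰp j (prm j) (fun U => Real.exp κ * ρ j U)`.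
Bałaban's class is a class of GAUGE-INVARIANT densities ([Balaban1985Averaging] (12)–(13) p.19: the renormalisation transformation maps
gauge-invariant densities to gauge-invariant ones; typed as the witness field `BalabanUVClass.Witness.gaugeInvariant`, ✓`Mem.gaugeInvariant`).
This file reads that back through the height vocabulary and the constant factor:

* §1 `gaugeInvariant_of_readAtLevel` (converse of ✓`ClassBumpRoom.gaugeInvariant_readAtLevel`: `fieldShift` intertwines the gauge actions),
  ★`gaugeInvariant_of_memAtHeight` (`MemAtHeight F ℰ j prm r → GaugeInvariant r`), ★`gaugeInvariant_of_memAtHeight_exp_mul` (clause ⑧'s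
  shape: `MemAtHeight … (fun U => Real.exp κ * r U) → GaugeInvariant r`, cancelling `exp κ > 0`).
* §2 `gaugeInvariant_of_plaqClass` — every function of the plaquette variables through conjugation-invariant readings is gauge invariant
  (lit ✓`T4ReTrLipUnitary.plaqHol_gaugeAct`: `U^u(∂p) = u(p₋)·U(∂p)·u(p₋)⁻¹`); instances: the organ's MARGINAL
  `U ↦ (L^j∕γ)·Σ_p c_p·(1 − reTr U(∂p))` (`gaugeInvariant_marginal`), the smooth small-field cut-off `sfCut` written out
  (`gaugeInvariant_sfCutTerm`); the window predicate `PlaqSmall` is lit ✓`B12RegularClassInvariance263.plaqSmall_gaugeAct_iff` (not restated).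
* §3 ★★`gaugeInvariant_organDiscrepancy` — from clause ⑧ at height `j` for BOTH towers: for EVERY `c : Plaq → ℝ` and every `a : ℝ`,
  `GaugeInvariant (fun U => Real.log (ρ j U) − Real.log (ρ′ j U) − a·Σ_p c p·(1 − reTr U(∂p)))` — the ideator's hypothesis (i) of
  `GRFlatEven.flatGradient_zero` ∕ critic #578, BY NAME, for the full gauge group (constant rotations a fortiori); also the cut-off-weighted
  discrepancy `sfCut·(log ρ − log ρ′)` (`gaugeInvariant_sfCut_mul_logRatio`).
* §4 ★`deriv_flatBond_organDiscrepancy_eq_zero` — docking on ✓p793256 `OrganTangentFlatAnchorEven.deriv_flatBond_eq_zero`: along every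
  inversion-odd one-bond curve `e` (`e(−t) = (e t)⁻¹`) through the flat configuration, the anchored derivative of the organ's remainder
  `log ρ_j − log ρ′_j − marginal` VANISHES at `t = 0`, the only residual input being (iv) differentiability at `0` (TN-GR (GR-a): the
  gradient channel costs no new letter family).

WHAT THIS IS NOT.  Symmetry bookkeeping; nothing of Bałaban's analysis is asserted or proved (the class is a PREDICATE; these are consequences
of its `gaugeInvariant` clause).  O1 (any edition), LIN∘, JEN∘∕JVAR∘, UNIQ-MAX∘, the five registered ∘-stubs, crux 20520
`FluctuationComparisonRegPrIntL` and the rung leaf `YM3TorusSU2` are NOT proved; no summit is proved by a helper.  R3 = SU(2) YM₃ on T³ —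
NOT d = 4, NOT infinite volume, NOT a mass gap, NOT Clay; the Yang–Mills mass gap is NOT proved.
-/

noncomputable section

open Function
open Literature.MathematicalPhysics.QuantumFieldTheory
open Literature.MathematicalPhysics.QuantumFieldTheory.Balaban1983to89
open Literature.MathematicalPhysics.QuantumFieldTheory.Balaban1983to89.T3ContinuumYM3Torus
open Literature.MathematicalPhysics.QuantumFieldTheory.Balaban1983to89.T3LevelShift
open Literature.MathematicalPhysics.QuantumFieldTheory.Balaban1983to89.BalabanUVClass
open Literature.MathematicalPhysics.QuantumFieldTheory.Balaban1983to89.T3UnitLawDensityEML (ℰp)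

namespace Summit.QuantumFields.YangMills.Theorems.OrganTangentWindowGaugeInvariance

/-! ## §1 Clause ⑧ ⇒ gauge invariance of the density -/

section Height

variable (F : T3Family) {G : Type*} [GaugeGroup G]
variable {ℰ : LoopAverage G} {j : ℕ} {prm : ClassParams} {r : GaugeField (F.P j) 0 G → ℝ}

/-- Gauge invariance descends from the reading of a height-`j` function on a run `K ≥ j`: `fieldShift` intertwines the gauge actions
(✓`T3LevelShift.fieldShift_gaugeAct`), and `fieldShift h.symm` inverts `fieldShift h`. [cite: Balaban1985Averaging, (8) p.19, (12) p.19] -/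
theorem gaugeInvariant_of_readAtLevel {K : ℕ} (hK : j ≤ K) (h : GaugeField.GaugeInvariant (readAtLevel F hK r)) :
    GaugeField.GaugeInvariant r := by
  intro u V
  have hsh := fieldShift_gaugeAct (G := G) (heightShift_eq F hK).symm u V
  rw [← readAtLevel_fieldShift_symm F hK r (GaugeField.gaugeAct u V), ← readAtLevel_fieldShift_symm F hK r V]
  exact (congrArg (readAtLevel F hK r) hsh).trans (h _ _)

variable [MeasurableSpace G]

/-- ★ **HEIGHT MEMBERS ARE GAUGE INVARIANT**: Bałaban's class consists of gauge-invariant densities (witness clause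
`Witness.gaugeInvariant`, ✓`Mem.gaugeInvariant`), and the reading on the run of the witness is undone by §1's first lemma.
[cite: Balaban1985Averaging, (12)-(13) p.19] -/
theorem gaugeInvariant_of_memAtHeight (h : MemAtHeight F ℰ j prm r) : GaugeField.GaugeInvariant r := by
  obtain ⟨K, hK, hm⟩ := h
  exact gaugeInvariant_of_readAtLevel F hK (Mem.gaugeInvariant hm)

/-- ★ **CLAUSE ⑧'S SHAPE** («membership modulo a constant factor»): if `e^κ·r` is a height-`j` member then `r` is gauge invariant
(cancel the positive constant). [cite: Balaban1985Averaging, (12)-(13) p.19] -/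
theorem gaugeInvariant_of_memAtHeight_exp_mul {κ : ℝ} (h : MemAtHeight F ℰ j prm (fun U => Real.exp κ * r U)) :
    GaugeField.GaugeInvariant r := by
  intro u V
  have key := gaugeInvariant_of_memAtHeight F h u V
  exact mul_left_cancel₀ (Real.exp_pos κ).ne' key

/-- The `∃ κ` form of clause ⑧, verbatim as the frame states it. [cite: Balaban1985Averaging, (12)-(13) p.19] -/
theorem gaugeInvariant_of_exists_memAtHeight_exp_mul (h : ∃ κ : ℝ, MemAtHeight F ℰ j prm (fun U => Real.exp κ * r U)) :
    GaugeField.GaugeInvariant r := by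
  obtain ⟨κ, hκ⟩ := h
  exact gaugeInvariant_of_memAtHeight_exp_mul F hκ

end Height

/-! ## §2 Functions of the plaquette variables through conjugation-invariant readings are gauge invariant -/

section PlaqClass

variable {P : Params} {j : ℕ} {G : Type*} [GaugeGroup G]

/-- ★ Every functional of the family of plaquette readings `p ↦ f p (U(∂p))`, with each `f p` invariant under conjugation, is gauge
invariant: `U^u(∂p) = u(p₋)·U(∂p)·u(p₋)⁻¹` (lit ✓`T4ReTrLipUnitary.plaqHol_gaugeAct`). [cite: Balaban1985Averaging, (9) p.19, (12) p.19] -/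
theorem gaugeInvariant_of_plaqClass {α β : Type*} (f : Plaq P j → G → β) (hf : ∀ p (g h : G), f p (h * g * h⁻¹) = f p g)
    (Φ : (Plaq P j → β) → α) :
    GaugeField.GaugeInvariant (fun U : GaugeField P j G => Φ (fun p => f p (GaugeField.plaqHol U p))) := by
  intro u U
  simp only [T4ReTrLipUnitary.plaqHol_gaugeAct, hf]

/-- `reTr U(∂p)` is a gauge-invariant reading of each plaquette. [cite: Balaban1985Averaging, (9) p.19, (12) p.19] -/
theorem gaugeInvariant_reTr_plaqHol (p : Plaq P j) :
    GaugeField.GaugeInvariant (fun U : GaugeField P j G => reTr (GaugeField.plaqHol U p)) :=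
  gaugeInvariant_of_plaqClass (fun _ g => reTr g) (fun _ g h => GaugeGroup.reTr_conj g h) (fun w => w p)

/-- `dist1 U(∂p) = |U(∂p) − 1|` is a gauge-invariant reading of each plaquette. [cite: Balaban1985Averaging, (9) p.19, (12) p.19] -/
theorem gaugeInvariant_dist1_plaqHol (p : Plaq P j) :
    GaugeField.GaugeInvariant (fun U : GaugeField P j G => dist1 (GaugeField.plaqHol U p)) :=
  gaugeInvariant_of_plaqClass (fun _ g => dist1 g) (fun _ g h => GaugeGroup.dist1_conj g h) (fun w => w p)

/-- ★ THE ORGAN'S MARGINAL is gauge invariant: `U ↦ a·Σ_p c_p·(1 − reTr U(∂p))` (O1's presentation `(c, a, w)` with `a := L^j∕γ`).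
[cite: Balaban1985Averaging, (9) p.19, (12) p.19] -/
theorem gaugeInvariant_marginal [Fintype (Plaq P j)] (a : ℝ) (c : Plaq P j → ℝ) :
    GaugeField.GaugeInvariant (fun U : GaugeField P j G => a * ∑ p, c p * (1 - reTr (GaugeField.plaqHol U p))) :=
  gaugeInvariant_of_plaqClass (fun _ g => reTr g) (fun _ g h => GaugeGroup.reTr_conj g h)
    (fun w => a * ∑ p, c p * (1 - w p))

/-- The SMOOTH SMALL-FIELD CUT-OFF of the organ-tangent line, written out (`sfCut θ U = ∏_p max 0 (min 1 ((24∕25·θ − dist1 U(∂p)) ∕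
((24∕25 − 1∕2)·θ)))`, the R-CUT-χ token of `Lines/organ_tangent.lean` v2.6 inlined), is gauge invariant; so is the generic ramp with any
constants `c₁, c₂`. [cite: Balaban1985Averaging, (9) p.19, (12) p.19] -/
theorem gaugeInvariant_sfCutTerm [Fintype (Plaq P j)] (c₁ c₂ θ : ℝ) :
    GaugeField.GaugeInvariant (fun U : GaugeField P j G =>
      ∏ p : Plaq P j, max 0 (min 1 ((c₂ * θ - dist1 (GaugeField.plaqHol U p)) / ((c₂ - c₁) * θ)))) :=
  gaugeInvariant_of_plaqClass (fun _ g => dist1 g) (fun _ g h => GaugeGroup.dist1_conj g h)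
    (fun w => ∏ p : Plaq P j, max 0 (min 1 ((c₂ * θ - w p) / ((c₂ - c₁) * θ))))

/-- Gauge-invariant functions form an algebra: differences. [folklore] -/
theorem gaugeInvariant_sub {R S : GaugeField P j G → ℝ} (hR : GaugeField.GaugeInvariant R) (hS : GaugeField.GaugeInvariant S) :
    GaugeField.GaugeInvariant (fun U => R U - S U) :=
  fun u U => by simp only [hR u U, hS u U]

/-- Gauge-invariant functions form an algebra: products. [folklore] -/
theorem gaugeInvariant_mul {R S : GaugeField P j G → ℝ} (hR : GaugeField.GaugeInvariant R) (hS : GaugeField.GaugeInvariant S) :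
    GaugeField.GaugeInvariant (fun U => R U * S U) :=
  fun u U => by simp only [hR u U, hS u U]

/-- The LOGARITHMIC RATIO of two gauge-invariant densities is gauge invariant. [folklore] -/
theorem gaugeInvariant_logRatio {ρ ρ' : GaugeField P j G → ℝ} (hρ : GaugeField.GaugeInvariant ρ) (hρ' : GaugeField.GaugeInvariant ρ') :
    GaugeField.GaugeInvariant (fun U => Real.log (ρ U) - Real.log (ρ' U)) :=
  fun u U => by simp only [hρ u U, hρ' u U]

end PlaqClass

/-! ## §3 The organ's discrepancy (minus its marginal) is gauge invariant, from clause ⑧ for both towers -/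

section Organ

variable (F : T3Family) {G : Type*} [GaugeGroup G] [MeasurableSpace G]
variable {ℰ : LoopAverage G} {j : ℕ} {prm : ClassParams} {ρj ρ'j : GaugeField (F.P j) 0 G → ℝ}

/-- ★★ **THE ORGAN'S REMAINDER IS GAUGE INVARIANT** (ideator `ym-r3-idea-1` g26 №21, hypothesis (i) of `GRFlatEven.flatGradient_zero`;
critic #578): if both height-`j` tower densities satisfy clause ⑧ of the O1 frame («membership modulo a constant»:
`∃ κ, MemAtHeight F ℰ j prm (e^κ·ρ)`), then for EVERY marginal presentation `(a, c)` the remainder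
`U ↦ log ρ_j U − log ρ′_j U − a·Σ_p c_p·(1 − reTr U(∂p))` is invariant under ALL gauge transformations (constant rotations a fortiori).
Any group `G`, any averaging `ℰ`. [cite: Balaban1985Averaging, (12)-(13) p.19; Balaban1985UV3, (41)-(47) pp.266-267] -/
theorem gaugeInvariant_organDiscrepancy
    (h8 : ∃ κ : ℝ, MemAtHeight F ℰ j prm (fun U => Real.exp κ * ρj U))
    (h8' : ∃ κ : ℝ, MemAtHeight F ℰ j prm (fun U => Real.exp κ * ρ'j U)) (a : ℝ) (c : Plaq (F.P j) 0 → ℝ) :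
    GaugeField.GaugeInvariant (fun U : GaugeField (F.P j) 0 G =>
      Real.log (ρj U) - Real.log (ρ'j U) - a * ∑ p, c p * (1 - reTr (GaugeField.plaqHol U p))) :=
  gaugeInvariant_sub
    (gaugeInvariant_logRatio (gaugeInvariant_of_exists_memAtHeight_exp_mul F h8)
      (gaugeInvariant_of_exists_memAtHeight_exp_mul F h8'))
    (gaugeInvariant_marginal a c)

/-- The bare logarithmic discrepancy `h_j = log ρ_j − log ρ′_j` of the two towers is gauge invariant (the case `c = 0`, stated directly).
[cite: Balaban1985Averaging, (12)-(13) p.19] -/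
theorem gaugeInvariant_organLogRatio
    (h8 : ∃ κ : ℝ, MemAtHeight F ℰ j prm (fun U => Real.exp κ * ρj U))
    (h8' : ∃ κ : ℝ, MemAtHeight F ℰ j prm (fun U => Real.exp κ * ρ'j U)) :
    GaugeField.GaugeInvariant (fun U : GaugeField (F.P j) 0 G => Real.log (ρj U) - Real.log (ρ'j U)) :=
  gaugeInvariant_logRatio (gaugeInvariant_of_exists_memAtHeight_exp_mul F h8)
    (gaugeInvariant_of_exists_memAtHeight_exp_mul F h8')

/-- The CUT-OFF-WEIGHTED fine discrepancy `sfCut θ · (log ρ − log ρ′)` (the integrand of the localised fibre mean `m = E′_χ[h | ·]` of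
VER∘∕LIN∘∕JEN∘, cut-off written out with generic ramp constants) is gauge invariant. [cite: Balaban1985Averaging, (12)-(13) p.19] -/
theorem gaugeInvariant_sfCut_mul_logRatio
    (h8 : ∃ κ : ℝ, MemAtHeight F ℰ j prm (fun U => Real.exp κ * ρj U))
    (h8' : ∃ κ : ℝ, MemAtHeight F ℰ j prm (fun U => Real.exp κ * ρ'j U)) (c₁ c₂ θ : ℝ) :
    GaugeField.GaugeInvariant (fun U : GaugeField (F.P j) 0 G =>
      (∏ p : Plaq (F.P j) 0, max 0 (min 1 ((c₂ * θ - dist1 (GaugeField.plaqHol U p)) / ((c₂ - c₁) * θ)))) *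
        (Real.log (ρj U) - Real.log (ρ'j U))) :=
  gaugeInvariant_mul (gaugeInvariant_sfCutTerm c₁ c₂ θ) (gaugeInvariant_organLogRatio F h8 h8')

end Organ

/-! ## §4 Docking on ✓`OrganTangentFlatAnchorEven`: the anchored one-bond derivative of the organ's remainder vanishes at the flat field -/

section Dock

open Summit.QuantumFields.YangMills.Theorems.OrganTangentFlatAnchorEven (deriv_flatBond_eq_zero)

variable (F : T3Family) {j : ℕ} {prm : ClassParams}
variable {ρj ρ'j : GaugeField (F.P j) 0 (Matrix.specialUnitaryGroup (Fin 2) ℂ) → ℝ}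

/-- ★ **(GR-a) FOR THE ORGAN, MODULO DIFFERENTIABILITY ONLY**: at the `SU(2)` averaging of record `ℰp`, if both tower densities satisfy
clause ⑧ at height `j`, then for every marginal presentation `(a, c)`, every bond `b` and every inversion-odd one-bond curve `e` through
the identity (`e(−t) = (e t)⁻¹`, e.g. `t ↦ exp(t·X)`), the derivative at `t = 0` of the organ's remainder along the one-bond excitation
`update 1 b (e t)` of the FLAT configuration is ZERO — provided only that it exists ((iv), to come from the analyticity predicate (β)).
Mechanism: §3 + ✓p793256 (gauge-invariant functions of a one-bond excitation of the flat field are inversion-even).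
[cite: Balaban1985Averaging, (12)-(13) p.19; Balaban1985UV3, (41)-(47) pp.266-267] -/
theorem deriv_flatBond_organDiscrepancy_eq_zero [DecidableEq (PBond (F.P j) 0)]
    (h8 : ∃ κ : ℝ, MemAtHeight F ℰp j prm (fun U => Real.exp κ * ρj U))
    (h8' : ∃ κ : ℝ, MemAtHeight F ℰp j prm (fun U => Real.exp κ * ρ'j U)) (a : ℝ) (c : Plaq (F.P j) 0 → ℝ)
    (b : PBond (F.P j) 0) {e : ℝ → Matrix.specialUnitaryGroup (Fin 2) ℂ} (he : ∀ t, e (-t) = (e t)⁻¹)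
    (hd : DifferentiableAt ℝ (fun t =>
      Real.log (ρj (update 1 b (e t))) - Real.log (ρ'j (update 1 b (e t))) -
        a * ∑ p, c p * (1 - reTr (GaugeField.plaqHol (update (1 : GaugeField (F.P j) 0 _) b (e t)) p))) 0) :
    deriv (fun t =>
      Real.log (ρj (update 1 b (e t))) - Real.log (ρ'j (update 1 b (e t))) -
        a * ∑ p, c p * (1 - reTr (GaugeField.plaqHol (update (1 : GaugeField (F.P j) 0 _) b (e t)) p))) 0 = 0 :=
  deriv_flatBond_eq_zero (R := fun U : GaugeField (F.P j) 0 (Matrix.specialUnitaryGroup (Fin 2) ℂ) =>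
      Real.log (ρj U) - Real.log (ρ'j U) - a * ∑ p, c p * (1 - reTr (GaugeField.plaqHol U p)))
    (gaugeInvariant_organDiscrepancy F h8 h8' a c) b he hd

/-- The same for the bare discrepancy `h_j = log ρ_j − log ρ′_j` (no marginal subtracted). [cite: Balaban1985Averaging, (12)-(13) p.19] -/
theorem deriv_flatBond_organLogRatio_eq_zero [DecidableEq (PBond (F.P j) 0)]
    (h8 : ∃ κ : ℝ, MemAtHeight F ℰp j prm (fun U => Real.exp κ * ρj U))
    (h8' : ∃ κ : ℝ, MemAtHeight F ℰp j prm (fun U => Real.exp κ * ρ'j U))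
    (b : PBond (F.P j) 0) {e : ℝ → Matrix.specialUnitaryGroup (Fin 2) ℂ} (he : ∀ t, e (-t) = (e t)⁻¹)
    (hd : DifferentiableAt ℝ (fun t => Real.log (ρj (update 1 b (e t))) - Real.log (ρ'j (update 1 b (e t)))) 0) :
    deriv (fun t => Real.log (ρj (update 1 b (e t))) - Real.log (ρ'j (update 1 b (e t)))) 0 = 0 :=
  deriv_flatBond_eq_zero (R := fun U : GaugeField (F.P j) 0 (Matrix.specialUnitaryGroup (Fin 2) ℂ) =>
      Real.log (ρj U) - Real.log (ρ'j U)) (gaugeInvariant_organLogRatio F h8 h8') b he hd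

end Dock

end Summit.QuantumFields.YangMills.Theorems.OrganTangentWindowGaugeInvariance

end
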